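import Literature.AlgebraicGeometry.HodgeTheory.GysinBaseChange
import HarnessLib

/-!
# The fibre integrals `(pr_X)_* pr_Y^* w` and `(pr_Y)_* pr_X^* w` of a top-degree class do not all vanish

Family `hodge`, layer `Literature/AlgebraicGeometry/HodgeTheory`. Companion of
`GysinBaseChangeOfKunneth` (`exists_complexGysin_map_ne_zero`: the same statement for the partial
projection `p₁₂ : X ⊗ (Y ⊗ Z) → X ⊗ Y`) for the two projections of ONE product `X ⊗ Y` of smooth
projective complex varieties (W. Fulton, *Young Tableaux*, App. B §B.1 (5)–(7): for the projection
`p : X × Y → X` of compact oriented manifolds `p_*(1 × [pt]^∨) = 1`, i.e. the fibre integral of the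
orientation class of the fibre is `1`; here, for an arbitrary orientation family `μ`, only the
non-vanishing is recorded):

* `exists_complexGysin_fst_map_snd_ne_zero` — some `w ∈ H^{2 dim Y}(Y(ℂ); ℂ)` has
  `(pr_X)_* (pr_Y^* w) ≠ 0` in `H⁰(X(ℂ); ℂ)`;
* `exists_complexGysin_snd_map_fst_ne_zero` — some `w ∈ H^{2 dim X}(X(ℂ); ℂ)` has
  `(pr_Y)_* (pr_X^* w) ≠ 0` in `H⁰(Y(ℂ); ℂ)`.

Proof (as in `exists_complexGysin_map_ne_zero`): a top-degree class `G₀` of `(X ⊗ Y)(ℂ)` pairs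
non-trivially with `[X ⊗ Y]` (universal coefficients over `ℂ`, `[X ⊗ Y] ≠ 0`); `G₀` is a combination
of cross products (Künneth spanning, `kunnethSpan_complexBetti`), which for degree reasons are
`pr_X^* a ∪ pr_Y^* w` with `a`, `w` of top degree, and
`⟨pr_X^* a ∪ pr_Y^* w, [X ⊗ Y]⟩ = ⟨pr_X^* a, pr_Y^* w ⌢ [X ⊗ Y]⟩ = ⟨a, (pr_X)_*(pr_Y^* w) ⌢ [X]⟩`.
Everything is proved; no named facts.

## References

* [FultonYoungTableaux1997] W. Fulton, Young Tableaux, CUP 1997, Appendix B §B.1 (5)–(7).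
* [HatcherAT2002] A. Hatcher, Algebraic Topology, CUP 2002, §3.2 Thm. 3.15, §3.1 Thm. 3.2, §3.3
  Thm. 3.26.
-/

noncomputable section

open CategoryTheory AlgebraicGeometry MonoidalCategory CartesianMonoidalCategory
open Literature.AlgebraicGeometry.Motives
open Literature.AlgebraicTopology.SingularHomology

namespace Literature.AlgebraicGeometry.HodgeTheory

section HodgeTheory

variable {l m : ℕ} {X Y : SchemeOver ℂ}

/-- A top-degree class of `(X ⊗ Y)(ℂ)` pairing non-trivially with the fundamental class, for `X`,
`Y` smooth projective (universal coefficients over `ℂ` and `[X ⊗ Y] ≠ 0`).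
[cite: HatcherAT2002, §3.1 Thm. 3.2 and §3.3 Thm. 3.26] -/
theorem exists_kroneckerPairing_fundamentalClass_tensor_ne_zero (μ : OrientationFamily)
    (hX : IsSmoothProjective l X) (hY : IsSmoothProjective m Y) :
    ∃ G₀ : complexBetti (X ⊗ Y) (2 * (l + m)),
      kroneckerPairing ℂ ℂ (ComplexPoints (X ⊗ Y)) (2 * (l + m)) G₀
        (μ (IsSmoothProjective.tensor_holds hX hY)).fundamentalClass ≠ 0 := by
  have hXY := IsSmoothProjective.tensor_holds hX hY
  letI := hXY.chartedSpace
  haveI := ComplexPoints.compactSpace_of_isSmoothProjective hXY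
  haveI := ComplexPoints.t2Space_of_isSmoothProjective hXY
  haveI := connectedSpace_complexPoints hXY
  have hne : (μ hXY).fundamentalClass ≠ 0 := fundamentalClass_ne_zero (μ hXY)
  obtain ⟨φ, hφ⟩ : ∃ φ : Module.Dual ℂ (singularHomology ℂ ℂ (ComplexPoints (X ⊗ Y))
      (2 * (l + m))), φ (μ hXY).fundamentalClass ≠ 0 := by
    by_contra h
    push Not at h
    exact hne ((Module.forall_dual_apply_eq_zero_iff ℂ _).1 h)
  obtain ⟨G₀, hG₀⟩ := kroneckerPairing_surjective ℂ (ComplexPoints (X ⊗ Y)) (2 * (l + m)) φ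
  exact ⟨G₀, by rw [hG₀]; exact hφ⟩

/-- **For some `w ∈ H^{2 dim Y}(Y(ℂ))`, `(pr_X)_* (pr_Y^* w) ≠ 0` in `H⁰(X(ℂ))`** (`X`, `Y` smooth
projective over `ℂ`, any orientation family `μ`; Fulton App. B (7), `p_*` of the orientation class
of the fibre is `1`). Proof in the module docstring.
[cite: FultonYoungTableaux1997, Appendix B §B.1 (5)–(7)] [cite: HatcherAT2002, §3.2 Thm. 3.15 and §3.1 Thm. 3.2] -/
theorem exists_complexGysin_fst_map_snd_ne_zero (μ : OrientationFamily)
    (hX : IsSmoothProjective l X) (hY : IsSmoothProjective m Y) :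
    ∃ w : complexBetti Y (2 * m),
      complexGysin μ (IsSmoothProjective.tensor_holds hX hY) hX (fst X Y)
        (show 2 * m + 2 * l = 0 + 2 * (l + m) by omega)
        (complexBetti.map (snd X Y) (2 * m) w) ≠ 0 := by
  have hμ : μ.HasPoincareDuality := OrientationFamily.hasPoincareDuality μ
  have hXY := IsSmoothProjective.tensor_holds hX hY
  obtain ⟨G₀, hG₀ne⟩ := exists_kroneckerPairing_fundamentalClass_tensor_ne_zero μ hX hY
  set κ := kroneckerPairing ℂ ℂ (ComplexPoints (X ⊗ Y)) (2 * (l + m)) with hκ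
  by_contra hall
  push Not at hall
  apply hG₀ne
  -- the pairing with `[X ⊗ Y]` kills every cross product `pr_X^* a ∪ pr_Y^* w` of top degrees
  have key : ∀ (a : complexBetti X (2 * l)) (w : complexBetti Y (2 * m)),
      κ (cupProduct (show 2 * l + 2 * m = 2 * (l + m) by omega)
        (complexBetti.map (fst X Y) (2 * l) a) (complexBetti.map (snd X Y) (2 * m) w))
        (μ hXY).fundamentalClass = 0 := by
    intro a w
    have hsign : ((-1 : ℂ) ^ (2 * l * (2 * m))) = 1 := Even.neg_one_pow ⟨l * (2 * m), by ring⟩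
    rw [cupProduct_gradedComm_holds ℂ _ _ (show 2 * m + 2 * l = 2 * (l + m) by omega), hsign,
      one_smul, hκ, kroneckerPairing_cupProduct]
    change kroneckerPairing ℂ ℂ _ _ (singularCohomology.map ℂ ℂ
      (AlgPoints.mapContinuous (L := ℂ) (fst X Y)) _ a) _ = 0
    rw [kroneckerPairing_map, ← capProduct_complexGysin hμ hXY hX (fst X Y)
      (show 2 * m + 2 * l = 0 + 2 * (l + m) by omega) _ (Nat.zero_add _), hall w, map_zero,
      LinearMap.zero_apply, map_zero]
  -- hence (Künneth spanning) it kills everything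
  have hle : Submodule.span ℂ {v | ∃ (i j : ℕ) (h : i + j = 2 * (l + m)) (a : complexBetti X i)
        (w : complexBetti Y j),
        v = cupProduct h (complexBetti.map (fst X Y) i a) (complexBetti.map (snd X Y) j w)} ≤
      LinearMap.ker (κ.flip (μ hXY).fundamentalClass) := by
    refine Submodule.span_le.2 ?_
    rintro _ ⟨i, j, h, a, w, rfl⟩
    rw [SetLike.mem_coe, LinearMap.mem_ker, LinearMap.flip_apply]
    rcases lt_trichotomy (2 * l) i with hi | hi | hi
    · haveI := subsingleton_complexBetti hX hi
      rw [Subsingleton.elim a 0, map_zero, map_zero, LinearMap.zero_apply, map_zero,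
        LinearMap.zero_apply]
    swap
    · haveI := subsingleton_complexBetti hY (show 2 * m < j by omega)
      rw [Subsingleton.elim w 0, map_zero, map_zero, map_zero, LinearMap.zero_apply]
    subst hi
    obtain rfl : j = 2 * m := by omega
    exact key a w
  exact hle (kunnethSpan_complexBetti hX hY _ G₀)

/-- **For some `w ∈ H^{2 dim X}(X(ℂ))`, `(pr_Y)_* (pr_X^* w) ≠ 0` in `H⁰(Y(ℂ))`** (the mirror
statement for the second projection). Proof: `⟨pr_X^* w ∪ pr_Y^* b, [X ⊗ Y]⟩ = ⟨b, (pr_Y)_*(pr_X^* w) ⌢ [Y]⟩`.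
[cite: FultonYoungTableaux1997, Appendix B §B.1 (5)–(7)] [cite: HatcherAT2002, §3.2 Thm. 3.15 and §3.1 Thm. 3.2] -/
theorem exists_complexGysin_snd_map_fst_ne_zero (μ : OrientationFamily)
    (hX : IsSmoothProjective l X) (hY : IsSmoothProjective m Y) :
    ∃ w : complexBetti X (2 * l),
      complexGysin μ (IsSmoothProjective.tensor_holds hX hY) hY (snd X Y)
        (show 2 * l + 2 * m = 0 + 2 * (l + m) by omega)
        (complexBetti.map (fst X Y) (2 * l) w) ≠ 0 := by
  have hμ : μ.HasPoincareDuality := OrientationFamily.hasPoincareDuality μ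
  have hXY := IsSmoothProjective.tensor_holds hX hY
  obtain ⟨G₀, hG₀ne⟩ := exists_kroneckerPairing_fundamentalClass_tensor_ne_zero μ hX hY
  set κ := kroneckerPairing ℂ ℂ (ComplexPoints (X ⊗ Y)) (2 * (l + m)) with hκ
  by_contra hall
  push Not at hall
  apply hG₀ne
  have key : ∀ (w : complexBetti X (2 * l)) (b : complexBetti Y (2 * m)),
      κ (cupProduct (show 2 * l + 2 * m = 2 * (l + m) by omega)
        (complexBetti.map (fst X Y) (2 * l) w) (complexBetti.map (snd X Y) (2 * m) b))
        (μ hXY).fundamentalClass = 0 := by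
    intro w b
    rw [hκ, kroneckerPairing_cupProduct]
    change kroneckerPairing ℂ ℂ _ _ (singularCohomology.map ℂ ℂ
      (AlgPoints.mapContinuous (L := ℂ) (snd X Y)) _ b) _ = 0
    rw [kroneckerPairing_map, ← capProduct_complexGysin hμ hXY hY (snd X Y)
      (show 2 * l + 2 * m = 0 + 2 * (l + m) by omega) _ (Nat.zero_add _), hall w, map_zero,
      LinearMap.zero_apply, map_zero]
  have hle : Submodule.span ℂ {v | ∃ (i j : ℕ) (h : i + j = 2 * (l + m)) (a : complexBetti X i)
        (w : complexBetti Y j),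
        v = cupProduct h (complexBetti.map (fst X Y) i a) (complexBetti.map (snd X Y) j w)} ≤
      LinearMap.ker (κ.flip (μ hXY).fundamentalClass) := by
    refine Submodule.span_le.2 ?_
    rintro _ ⟨i, j, h, a, w, rfl⟩
    rw [SetLike.mem_coe, LinearMap.mem_ker, LinearMap.flip_apply]
    rcases lt_trichotomy (2 * l) i with hi | hi | hi
    · haveI := subsingleton_complexBetti hX hi
      rw [Subsingleton.elim a 0, map_zero, map_zero, LinearMap.zero_apply, map_zero,
        LinearMap.zero_apply]
    swap
    · haveI := subsingleton_complexBetti hY (show 2 * m < j by omega)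
      rw [Subsingleton.elim w 0, map_zero, map_zero, map_zero, LinearMap.zero_apply]
    subst hi
    obtain rfl : j = 2 * m := by omega
    exact key a w
  exact hle (kunnethSpan_complexBetti hX hY _ G₀)

/-- **`(pr_X)_* (pr_Y^* ν) ≠ 0` for EVERY non-zero top-degree class `ν` of `Y(ℂ)`**: the top
cohomology `H^{2 dim Y}(Y(ℂ); ℂ)` is a line (`exists_eq_smul_of_top`), and the fibre integral is
linear. [cite: FultonYoungTableaux1997, Appendix B §B.1 (5)–(7)] [cite: HatcherAT2002, §3.3 Thm. 3.26] -/
theorem complexGysin_fst_map_snd_ne_zero (μ : OrientationFamily)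
    (hX : IsSmoothProjective l X) (hY : IsSmoothProjective m Y) {ν : complexBetti Y (2 * m)}
    (hν : ν ≠ 0) :
    complexGysin μ (IsSmoothProjective.tensor_holds hX hY) hX (fst X Y)
        (show 2 * m + 2 * l = 0 + 2 * (l + m) by omega)
        (complexBetti.map (snd X Y) (2 * m) ν) ≠ 0 := by
  obtain ⟨w, hw⟩ := exists_complexGysin_fst_map_snd_ne_zero μ hX hY
  obtain ⟨t, rfl⟩ := exists_eq_smul_of_top μ hY hν w
  intro h
  apply hw
  rw [map_smul, map_smul, h, smul_zero]

/-- **`(pr_Y)_* (pr_X^* ν) ≠ 0` for EVERY non-zero top-degree class `ν` of `X(ℂ)`** (mirror).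
[cite: FultonYoungTableaux1997, Appendix B §B.1 (5)–(7)] [cite: HatcherAT2002, §3.3 Thm. 3.26] -/
theorem complexGysin_snd_map_fst_ne_zero (μ : OrientationFamily)
    (hX : IsSmoothProjective l X) (hY : IsSmoothProjective m Y) {ν : complexBetti X (2 * l)}
    (hν : ν ≠ 0) :
    complexGysin μ (IsSmoothProjective.tensor_holds hX hY) hY (snd X Y)
        (show 2 * l + 2 * m = 0 + 2 * (l + m) by omega)
        (complexBetti.map (fst X Y) (2 * l) ν) ≠ 0 := by
  obtain ⟨w, hw⟩ := exists_complexGysin_snd_map_fst_ne_zero μ hX hY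
  obtain ⟨t, rfl⟩ := exists_eq_smul_of_top μ hX hν w
  intro h
  apply hw
  rw [map_smul, map_smul, h, smul_zero]

end HodgeTheory

end Literature.AlgebraicGeometry.HodgeTheory

end
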